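import Mathlib
import HarnessLib
import Literature.Analysis.UnboundedOperators.HeatKernelHeatEquation
import Literature.Analysis.UnboundedOperators.HeatKernelBoundedData
import Literature.Analysis.UnboundedOperators.HeatKernelSmooth
import Summits.NavierStokesRegularity.NavierStokesRegularity.Theorems.SymmetryModuliCountAxisymEndLiouvilleStubWeakMaxLocal

/-!
# Route `AxisTwistDoor`, crux `AveragedConeLiouville` (stmt-NavierStokesRegularity-26889), line `lrt_shell` —
# discharging the classical positivity propagation `PositivityPropagationFactC` WITHOUT Nazarov–Ural'tseva, brick P1:
# COMPARISON WITH A CALORIC BARRIER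

The line `lrt_shell` closes the crux conditionally on two literature facts (closing theorem
`averagedConeLiouville_of_facts`, p628780); the second one, Nazarov–Ural'tseva 2011 Cor. 3.2, is consumed only through
the CLASSICAL closed-cylinder statement `PositivityPropagationFactC` (Defs): a non-negative `C²` supersolution `V` of
`∂ₜV − ΔV + b·∇V ≥ 0` with a bounded `C¹` drift, occupying measure `≥ δ` above level `λ` at an early time, is `≥ βλ` on
the inner half-cylinder later.  For CLASSICAL supersolutions and BOUNDED drifts this needs no De Giorgi–Nash–Moser
theory: it follows from the comparison principle with explicit caloric barriers.  This file is the comparison step.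

* `continuousOn_caloric` — the caloric function started at time `s` (`e^{(t−s)Δ} g (x)` for `t > s`, `g x` at
  `t = s`) is jointly continuous on `[s, ∞) × ℝ³` for bounded continuous `g` (tree:
  `tendsto_heatExtension_nhdsWithin_prod`, `continuousOn_uncurry_heatExtension`).
* `barrier_comparison` — **the comparison lemma**: on a cylinder `[s, s+τ] × B̄(x₁, R)` on a neighbourhood of which `V`
  is `C²`, with `|b| ≤ Λ`, `V ≥ 0`, `∂ₜV − ΔV + ⟪b, ∇V⟫ ≥ 0` inside, `V(s, ·) ≥ μ g` (`0 ≤ g ≤ 1` continuous,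
  `μ ≥ 0`), `g ≤ m` and `e^{(t−s)Δ} g ≤ m` on the lateral boundary, one has
  `V(t, x) ≥ μ (e^{(t−s)Δ} g (x) − m − A √(t − s))` for `s < t ≤ s + τ`, as soon as `A ≥ 2·2^{3/2} Λ`.  Indeed
  `z = μ(e^{(t−s)Δ}g − m − A√(t−s))` is a classical subsolution: `∂ₜ e^{σΔ}g = Δ e^{σΔ}g` (tree:
  `hasDerivAt_heatExtension_time`) and `|⟪b, ∇e^{σΔ}g⟫| ≤ Λ · 2^{3/2} σ^{−1/2}` (tree:
  `norm_fderiv_heatExtension_le_of_bounded`) is paid by `d/dt (A√(t−s)) = A/(2√(t−s))`; the weak parabolic maximum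
  principle of the tree with slices `C²` only inside (`stub_weakMaxPrincipleLocal`, Lieberman 1996 Ch. II
  Lemma 2.1/2.3) applied to `z − V` concludes.  `div b = 0` is not used.

Seat ns-atd-p1 (LEAD g2).  WHAT THIS IS NOT: not a statement about Navier–Stokes regularity; a linear parabolic
comparison lemma serving a STAGED door route.  Lands `--supports` the crux item as a helper.
-/

noncomputable section

-- the summit and its single sub-problem share the name (CONVENTIONS §1), as in every Theorems file
set_option linter.dupNamespace false

namespace Summit.NavierStokesRegularity.NavierStokesRegularity.Theorems.AveragedConeLiouville.PositivityBarrier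

open scoped InnerProductSpace ENNReal Laplacian Topology NNReal
open Set Function MeasureTheory Metric Filter
open Literature.Analysis.UnboundedOperators
open Summit.NavierStokesRegularity.NavierStokesRegularity.Theorems.AxisymEndLiouville.AbsorbingAxisSwirlExtinction

/-! ### The caloric function started at time `s` -/

/-- A bounded continuous function is in `L^∞`. -/
theorem memLp_top_of_continuous {g : (EuclideanSpace ℝ (Fin 3)) → ℝ} (hg : Continuous g) {C : ℝ} (hC : ∀ z, ‖g z‖ ≤ C) :
    MemLp g ∞ (volume : Measure (EuclideanSpace ℝ (Fin 3))) :=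
  memLp_top_of_bound hg.aestronglyMeasurable C (Eventually.of_forall hC)

/-- **Joint continuity of the caloric function started at time `s`** — `e^{(t−s)Δ} g (x)` for `t > s`, the datum
`g x` at `t = s` (where the tree's `heatExtension g 0` is junk) — on `[s, ∞) × ℝ³`, for bounded continuous data
(Evans, PDE §2.3.1 Thm 1 (iii) at `t = s`, Thm 1 (i) for `t > s`). -/
theorem continuousOn_caloric {g : (EuclideanSpace ℝ (Fin 3)) → ℝ} (hg : Continuous g) {C : ℝ} (hC : ∀ z, ‖g z‖ ≤ C) (s : ℝ) :
    ContinuousOn (fun q : ℝ × (EuclideanSpace ℝ (Fin 3)) => if s < q.1 then heatExtension g (q.1 - s) q.2 else g q.2)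
      (Ici s ×ˢ univ) := by
  rintro ⟨t, x⟩ ⟨ht, -⟩
  simp only [mem_Ici] at ht
  -- the shifted caloric extension `(t, x) ↦ e^{(t−s)Δ} g (x)` and the shift map
  set sh : ℝ × (EuclideanSpace ℝ (Fin 3)) → ℝ × (EuclideanSpace ℝ (Fin 3)) := fun q => (q.1 - s, q.2) with hsh
  have hshc : Continuous sh := by fun_prop
  rcases eq_or_lt_of_le ht with rfl | hst
  · -- `t = s`: split `[s, ∞) × ℝ³` into the bottom `{s} × ℝ³` and the open part `(s, ∞) × ℝ³`
    have hsplit : Ici s ×ˢ (univ : Set (EuclideanSpace ℝ (Fin 3))) = {s} ×ˢ univ ∪ Ioi s ×ˢ univ := by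
      rw [← union_prod, ← Ioi_insert, insert_eq]
    rw [hsplit]
    refine ContinuousWithinAt.union ?_ ?_
    · -- on the bottom the function is `g`
      have h1 : ContinuousWithinAt (fun q : ℝ × (EuclideanSpace ℝ (Fin 3)) => g q.2) ({s} ×ˢ univ) (s, x) :=
        (hg.comp continuous_snd).continuousWithinAt
      refine h1.congr (fun q hq => ?_) (by simp)
      obtain ⟨hq1, -⟩ := mem_prod.1 hq
      simp only [mem_singleton_iff] at hq1
      simp [hq1]
    · -- on the open part it is the caloric extension, continuous down to `(s, x)` by Evans Thm 1 (iii)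
      have hlim := tendsto_heatExtension_nhdsWithin_prod (F := ℝ) hg hC x
      have hmaps : MapsTo sh (Ioi s ×ˢ univ) (Ioi 0 ×ˢ univ) := by
        rintro ⟨t', x'⟩ ⟨ht', -⟩
        exact ⟨by simpa [hsh] using ht', mem_univ _⟩
      have hsh0 : sh (s, x) = (0, x) := by simp [hsh]
      have h2 : Tendsto sh (𝓝[Ioi s ×ˢ univ] (s, x)) (𝓝[Ioi 0 ×ˢ univ] (0, x)) := by
        rw [← hsh0]
        exact hshc.continuousWithinAt.tendsto_nhdsWithin hmaps
      have h3 : Tendsto (fun q : ℝ × (EuclideanSpace ℝ (Fin 3)) => heatExtension g (sh q).1 (sh q).2) (𝓝[Ioi s ×ˢ univ] (s, x))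
          (𝓝 (g x)) := hlim.comp h2
      show Tendsto _ _ _
      rw [show (fun q : ℝ × (EuclideanSpace ℝ (Fin 3)) => if s < q.1 then heatExtension g (q.1 - s) q.2 else g q.2) (s, x) = g x by
        simp]
      refine h3.congr' ?_
      filter_upwards [self_mem_nhdsWithin] with q hq
      obtain ⟨h1, -⟩ := mem_prod.1 hq
      simp only [mem_Ioi] at h1
      simp [hsh, if_pos h1]
  · -- `t > s`: near `(t, x)` the function is the (jointly continuous) caloric extension
    have hco := continuousOn_uncurry_heatExtension (F := ℝ) hg hC
    have hmem : sh (t, x) ∈ Ioi (0 : ℝ) ×ˢ (univ : Set (EuclideanSpace ℝ (Fin 3))) := ⟨by simpa [hsh] using hst, mem_univ _⟩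
    have hat : ContinuousAt (fun q : ℝ × (EuclideanSpace ℝ (Fin 3)) => heatExtension g (sh q).1 (sh q).2) (t, x) :=
      (hco.continuousAt ((isOpen_Ioi.prod isOpen_univ).mem_nhds hmem)).comp hshc.continuousAt
    refine (hat.congr ?_).continuousWithinAt
    have hopen : IsOpen {q : ℝ × (EuclideanSpace ℝ (Fin 3)) | s < q.1} := isOpen_lt continuous_const continuous_fst
    filter_upwards [hopen.mem_nhds (show (t, x) ∈ {q : ℝ × (EuclideanSpace ℝ (Fin 3)) | s < q.1} from hst)] with q hq
    simp [hsh, if_pos (show s < q.1 from hq)]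

/-! ### The comparison lemma -/

/-- The gradient constant of the caloric extension in `ℝ³`: `‖∇e^{σΔ}g(x)‖ ≤ 2^{3/2} σ^{−1/2}` for `0 ≤ g ≤ 1`
(tree: `norm_fderiv_heatExtension_le_of_bounded`). -/
theorem norm_fderiv_heatExtension_le_three {g : (EuclideanSpace ℝ (Fin 3)) → ℝ} (hg : Continuous g) (hg0 : ∀ x, 0 ≤ g x)
    (hg1 : ∀ x, g x ≤ 1) {σ : ℝ} (hσ : 0 < σ) (x : (EuclideanSpace ℝ (Fin 3))) :
    ‖fderiv ℝ (heatExtension g σ) x‖ ≤ (2 : ℝ) ^ ((3 : ℝ) / 2) * σ ^ (-(1 / 2 : ℝ)) := by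
  have hC : ∀ z, ‖g z‖ ≤ 1 := fun z => by
    rw [Real.norm_of_nonneg (hg0 z)]; exact hg1 z
  have h := norm_fderiv_heatExtension_le_of_bounded (F := ℝ) hg.aestronglyMeasurable hC hσ x
  simp only [finrank_euclideanSpace, Fintype.card_fin, Nat.cast_ofNat, mul_one] at h
  exact h

/-- **Comparison with a caloric barrier.**  Let `V` be `C²` on an open neighbourhood `W` of the closed cylinder
`[s, s+τ] × B̄(x₁, R)`, `V ≥ 0` there, `∂ₜV − ΔV + ⟪b, ∇V⟫ ≥ 0` with `|b| ≤ Λ` on `(s, s+τ] × B(x₁, R)`; let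
`g` be continuous with `0 ≤ g ≤ 1`, `μ ≥ 0`, `V(s, ·) ≥ μ g` on `B̄(x₁, R)`, and let the caloric function
`g` and `e^{(t−s)Δ} g` be `≤ m` on the sphere `∂B(x₁, R)` for `s < t ≤ s + τ`, with `m ≥ 0`.  If `A ≥ 2·2^{3/2}Λ`
then `V(t, x) ≥ μ (e^{(t−s)Δ} g (x) − m − A√(t−s))` on `(s, s+τ] × B̄(x₁, R)`. -/
theorem barrier_comparison
    {V : ℝ → (EuclideanSpace ℝ (Fin 3)) → ℝ} {b : ℝ → (EuclideanSpace ℝ (Fin 3)) → (EuclideanSpace ℝ (Fin 3))} {W : Set (ℝ × (EuclideanSpace ℝ (Fin 3)))} {x₁ : (EuclideanSpace ℝ (Fin 3))} {s τ R Λ μ m A : ℝ} {g : (EuclideanSpace ℝ (Fin 3)) → ℝ}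
    (hW : IsOpen W) (hWsub : Icc s (s + τ) ×ˢ closedBall x₁ R ⊆ W)
    (hV : ContDiffOn ℝ 2 (uncurry V) W) (hΛ : 0 ≤ Λ)
    (hb : ∀ t ∈ Ioc s (s + τ), ∀ x ∈ ball x₁ R, ‖b t x‖ ≤ Λ)
    (hV0 : ∀ t ∈ Icc s (s + τ), ∀ x ∈ closedBall x₁ R, 0 ≤ V t x)
    (hsup : ∀ t ∈ Ioc s (s + τ), ∀ x ∈ ball x₁ R,
      0 ≤ deriv (fun σ => V σ x) t - (Δ (V t)) x + ⟪b t x, gradient (V t) x⟫_ℝ)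
    (hg : Continuous g) (hg0 : ∀ x, 0 ≤ g x) (hg1 : ∀ x, g x ≤ 1) (hμ : 0 ≤ μ)
    (hA : 2 * (2 : ℝ) ^ ((3 : ℝ) / 2) * Λ ≤ A)
    (hinit : ∀ x ∈ closedBall x₁ R, μ * g x ≤ V s x)
    (hm : 0 ≤ m) (hlat0 : ∀ x, dist x x₁ = R → g x ≤ m)
    (hlat : ∀ t ∈ Ioc s (s + τ), ∀ x, dist x x₁ = R → heatExtension g (t - s) x ≤ m) :
    ∀ t ∈ Ioc s (s + τ), ∀ x ∈ closedBall x₁ R,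
      μ * (heatExtension g (t - s) x - m - A * Real.sqrt (t - s)) ≤ V t x := by
  -- data for the weak maximum principle; `cal` = the caloric function started at time `s`
  set K : Set (EuclideanSpace ℝ (Fin 3)) := closedBall x₁ R with hK
  set U : Set (EuclideanSpace ℝ (Fin 3)) := ball x₁ R with hU
  set cal : ℝ → (EuclideanSpace ℝ (Fin 3)) → ℝ := fun t x => if s < t then heatExtension g (t - s) x else g x with hcal
  have cal_of_lt : ∀ {t : ℝ}, s < t → ∀ x, cal t x = heatExtension g (t - s) x := fun h x => if_pos h
  have cal_self : ∀ x, cal s x = g x := fun x => if_neg (lt_irrefl s)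
  set w : ℝ → (EuclideanSpace ℝ (Fin 3)) → ℝ := fun t x => μ * (cal t x - m - A * Real.sqrt (t - s)) - V t x with hw
  set wt : ℝ → (EuclideanSpace ℝ (Fin 3)) → ℝ := fun t x =>
    μ * ((Δ (heatExtension g (t - s))) x - A / (2 * Real.sqrt (t - s))) - deriv (fun σ => V σ x) t with hwt
  have hgC : ∀ z, ‖g z‖ ≤ 1 := fun z => by
    rw [Real.norm_of_nonneg (hg0 z)]; exact hg1 z
  have hmem : MemLp g ∞ (volume : Measure (EuclideanSpace ℝ (Fin 3))) := memLp_top_of_continuous hg hgC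
  have hA0 : 0 ≤ A := le_trans (by positivity) hA
  -- points of the closed cylinder lie in `W`
  have hinW : ∀ t ∈ Icc s (s + τ), ∀ x ∈ K, (t, x) ∈ W := fun t ht x hx => hWsub ⟨ht, hx⟩
  -- smoothness of the caloric extension at positive times
  have hHs : ∀ t, s < t → ContDiff ℝ 2 (heatExtension g (t - s)) := fun t hst =>
    contDiff_infty.1 (contDiff_heatExtension_holds (E := (EuclideanSpace ℝ (Fin 3))) (F := ℝ) hmem le_top (by linarith)) 2
  -- `C²` slices of `V` on the open ball
  have hVt : ∀ t ∈ Icc s (s + τ), ContDiffOn ℝ 2 (V t) U := by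
    intro t ht
    have hmaps : MapsTo (fun x : (EuclideanSpace ℝ (Fin 3)) => (t, x)) U W := fun x hx => hinW t ht x (ball_subset_closedBall hx)
    have h1 : ContDiffOn ℝ 2 (fun x : (EuclideanSpace ℝ (Fin 3)) => (t, x)) U := (contDiffOn_const.prodMk contDiffOn_id)
    exact hV.comp h1 hmaps
  ---------------------------------------------------------------- (hc) joint continuity
  have hc : ContinuousOn (uncurry w) (Icc s (s + τ) ×ˢ K) := by
    have h1 : ContinuousOn (fun q : ℝ × (EuclideanSpace ℝ (Fin 3)) => cal q.1 q.2) (Icc s (s + τ) ×ˢ K) :=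
      (continuousOn_caloric hg hgC s).mono (prod_mono Icc_subset_Ici_self (subset_univ _))
    have h2 : ContinuousOn (fun q : ℝ × (EuclideanSpace ℝ (Fin 3)) => A * Real.sqrt (q.1 - s)) (Icc s (s + τ) ×ˢ K) := by
      fun_prop
    have h3 : ContinuousOn (fun q : ℝ × (EuclideanSpace ℝ (Fin 3)) => V q.1 q.2) (Icc s (s + τ) ×ˢ K) := hV.continuousOn.mono hWsub
    exact ((continuousOn_const.mul ((h1.sub continuousOn_const).sub h2)).sub h3).congr fun q _ => rfl
  ---------------------------------------------------------------- (h2) `C²` slices on `U`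
  have h2 : ∀ t ∈ Ioc s (s + τ), ContDiffOn ℝ 2 (w t) U := by
    intro t ht
    have hst : s < t := ht.1
    have hwt' : w t = fun x => μ * (heatExtension g (t - s) x - m - A * Real.sqrt (t - s)) - V t x := by
      funext x; simp [hw, cal_of_lt hst]
    rw [hwt']
    exact (contDiffOn_const.mul (((hHs t hst).contDiffOn.sub contDiffOn_const).sub contDiffOn_const)).sub
      (hVt t (Ioc_subset_Icc_self ht))
  ---------------------------------------------------------------- (ht) left time derivative
  have hder : ∀ t ∈ Ioc s (s + τ), ∀ x ∈ U, HasDerivWithinAt (fun σ => w σ x) (wt t x) (Icc s t) t := by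
    intro t ht x hx
    have hst : s < t := ht.1
    have hts : 0 < t - s := by linarith
    -- the caloric part
    have h1 : HasDerivAt (fun σ' => heatExtension g σ' x) ((Δ (heatExtension g (t - s))) x) (t - s) :=
      hasDerivAt_heatExtension_time (F := ℝ) hts hmem le_top x
    have h1' : HasDerivAt (fun σ => heatExtension g (σ - s) x) ((Δ (heatExtension g (t - s))) x) t :=
      h1.comp_sub_const t s
    have hcalD : HasDerivAt (fun σ => cal σ x) ((Δ (heatExtension g (t - s))) x) t := by
      refine h1'.congr_of_eventuallyEq ?_
      have hopen : IsOpen {σ : ℝ | s < σ} := isOpen_lt continuous_const continuous_id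
      filter_upwards [hopen.mem_nhds (show t ∈ {σ : ℝ | s < σ} from hst)] with σ hσ
      exact cal_of_lt hσ x
    -- the square root
    have hsqD : HasDerivAt (fun σ => A * Real.sqrt (σ - s)) (A * (1 / (2 * Real.sqrt (t - s)))) t := by
      have h := ((hasDerivAt_id t).sub_const s).sqrt (by simp only [id]; exact hts.ne')
      simpa using h.const_mul A
    -- the supersolution
    have hVD : HasDerivAt (fun σ => V σ x) (deriv (fun σ => V σ x) t) t := by
      have hdiff : DifferentiableAt ℝ (uncurry V) (t, x) :=
        (hV.differentiableOn (by norm_num)).differentiableAt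
          (hW.mem_nhds (hinW t (Ioc_subset_Icc_self ht) x (ball_subset_closedBall hx)))
      have hline : DifferentiableAt ℝ (fun σ : ℝ => (σ, x)) t := by fun_prop
      have hd : DifferentiableAt ℝ (fun σ => V σ x) t := by
        have := hdiff.comp t hline
        simpa [Function.comp_def] using this
      exact hd.hasDerivAt
    have hall := ((((hcalD.sub_const m).sub hsqD).const_mul μ).sub hVD)
    have heq : μ * ((Δ (heatExtension g (t - s))) x - A * (1 / (2 * Real.sqrt (t - s)))) -
        deriv (fun σ => V σ x) t = wt t x := by
      simp only [hwt]; ring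
    rw [heq] at hall
    exact hall.hasDerivWithinAt
  ---------------------------------------------------------------- (hsub) the sub-solution implication
  have hsub : ∀ t ∈ Ioc s (s + τ), ∀ x ∈ U, fderiv ℝ (w t) x = 0 → (Δ (w t)) x ≤ 0 → wt t x ≤ 0 := by
    intro t ht x hx hgrad hlap
    have hst : s < t := ht.1
    have hts : 0 < t - s := by linarith
    set H : (EuclideanSpace ℝ (Fin 3)) → ℝ := heatExtension g (t - s) with hH
    have hHc : ContDiff ℝ 2 H := hHs t hst
    have hHx : ContDiffAt ℝ 2 H x := hHc.contDiffAt
    have hVx : ContDiffAt ℝ 2 (V t) x := (hVt t (Ioc_subset_Icc_self ht)).contDiffAt (isOpen_ball.mem_nhds hx)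
    -- `w t` as a difference of `C²` functions
    set c : ℝ := m + A * Real.sqrt (t - s) with hc'
    have hwt' : w t = (μ • fun y => H y - c) - V t := by
      funext y
      simp only [hw, cal_of_lt hst, Pi.sub_apply, Pi.smul_apply, smul_eq_mul, hH, hc']
      ring
    have hHc1 : ContDiffAt ℝ 2 (fun y => H y - c) x := hHx.sub contDiffAt_const
    have hHc2 : ContDiffAt ℝ 2 (μ • fun y => H y - c) x := hHc1.const_smul μ
    -- the Laplacian of `w t`
    have hlapw : (Δ (w t)) x = μ * (Δ H) x - (Δ (V t)) x := by
      rw [hwt', hHc2.laplacian_sub hVx, InnerProductSpace.laplacian_smul μ hHc1, smul_eq_mul]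
      have h5 : (Δ (fun y => H y - c)) x = (Δ H) x := by
        have h6 : (fun y => H y - c) = H - fun _ => c := by funext y; simp
        rw [h6, hHx.laplacian_sub contDiffAt_const]
        simp
      rw [h5]
    -- the gradient of `w t`
    have hfd : fderiv ℝ (V t) x = μ • fderiv ℝ H x := by
      have hdH : DifferentiableAt ℝ H x := hHx.differentiableAt (by norm_num)
      have hdV : DifferentiableAt ℝ (V t) x := hVx.differentiableAt (by norm_num)
      have hd1 : DifferentiableAt ℝ (fun y => H y - c) x := hdH.sub_const c
      have hd2 : DifferentiableAt ℝ (μ • fun y => H y - c) x := hd1.const_smul μ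
      have h7 : fderiv ℝ (w t) x = μ • fderiv ℝ H x - fderiv ℝ (V t) x := by
        rw [hwt', fderiv_sub hd2 hdV, fderiv_const_smul hd1, fderiv_sub_const]
      rw [h7] at hgrad
      exact (sub_eq_zero.1 hgrad).symm
    -- the drift term
    have hdrift : ⟪b t x, gradient (V t) x⟫_ℝ ≤ μ * ((2 : ℝ) ^ ((3 : ℝ) / 2) * (t - s) ^ (-(1 / 2 : ℝ))) * Λ := by
      rw [real_inner_comm, inner_gradient_left, hfd,
        show (μ • fderiv ℝ H x) (b t x) = μ * fderiv ℝ H x (b t x) from rfl]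
      have h8 : fderiv ℝ H x (b t x) ≤ ‖fderiv ℝ H x‖ * ‖b t x‖ :=
        (le_abs_self _).trans (by simpa [Real.norm_eq_abs] using (fderiv ℝ H x).le_opNorm (b t x))
      have h9 : ‖fderiv ℝ H x‖ * ‖b t x‖ ≤ ((2 : ℝ) ^ ((3 : ℝ) / 2) * (t - s) ^ (-(1 / 2 : ℝ))) * Λ :=
        mul_le_mul (norm_fderiv_heatExtension_le_three hg hg0 hg1 hts x) (hb t ht x hx) (norm_nonneg _)
          (by positivity)
      rw [mul_assoc]
      exact mul_le_mul_of_nonneg_left (h8.trans h9) hμ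
    -- the barrier pays for the drift: `2^{3/2} (t−s)^{−1/2} Λ ≤ A / (2 √(t−s))`
    have hpay : (2 : ℝ) ^ ((3 : ℝ) / 2) * (t - s) ^ (-(1 / 2 : ℝ)) * Λ ≤ A / (2 * Real.sqrt (t - s)) := by
      have hsq : 0 < Real.sqrt (t - s) := Real.sqrt_pos.2 hts
      have h10 : (t - s) ^ (-(1 / 2 : ℝ)) = 1 / Real.sqrt (t - s) := by
        rw [Real.rpow_neg hts.le, Real.sqrt_eq_rpow, inv_eq_one_div]
      rw [h10, le_div_iff₀ (by positivity)]
      have : (2 : ℝ) ^ ((3 : ℝ) / 2) * (1 / Real.sqrt (t - s)) * Λ * (2 * Real.sqrt (t - s)) =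
          2 * (2 : ℝ) ^ ((3 : ℝ) / 2) * Λ := by
        field_simp
      rw [this]
      exact hA
    -- assemble
    have hsupx := hsup t ht x hx
    have hwtx : wt t x = μ * ((Δ H) x - A / (2 * Real.sqrt (t - s))) - deriv (fun σ => V σ x) t := rfl
    rw [hwtx, mul_sub]
    rw [hlapw] at hlap
    have h11 := mul_le_mul_of_nonneg_left hpay hμ
    linarith [h11, hdrift, hlap, hsupx]
  ---------------------------------------------------------------- parabolic boundary
  have hbot : ∀ x ∈ K, w s x ≤ 0 := by
    intro x hx
    have h1 := hinit x hx
    simp only [hw, cal_self, sub_self, Real.sqrt_zero, mul_zero, sub_zero]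
    nlinarith [mul_nonneg hμ hm]
  have hlat' : ∀ t ∈ Icc s (s + τ), ∀ x ∈ K \ U, w t x ≤ 0 := by
    intro t ht x hx
    have hdist : dist x x₁ = R := by
      have h1 : dist x x₁ ≤ R := mem_closedBall.1 hx.1
      have h2 : ¬ dist x x₁ < R := fun h => hx.2 (mem_ball.2 h)
      push Not at h2
      exact le_antisymm h1 h2
    have h3 : cal t x ≤ m := by
      rcases eq_or_lt_of_le ht.1 with h | h
      · rw [← h, cal_self]; exact hlat0 x hdist
      · rw [cal_of_lt h]; exact hlat t ⟨h, ht.2⟩ x hdist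
    have h4 := hV0 t ht x hx.1
    have h5 : 0 ≤ A * Real.sqrt (t - s) := mul_nonneg hA0 (Real.sqrt_nonneg _)
    simp only [hw]
    nlinarith [mul_nonneg hμ hm, mul_nonneg hμ h5, mul_le_mul_of_nonneg_left h3 hμ]
  ---------------------------------------------------------------- conclusion
  have key := stub_weakMaxPrincipleLocal K U (isCompact_closedBall x₁ R) isOpen_ball ball_subset_closedBall
    s (s + τ) w wt hc h2 hder hsub hbot hlat'
  intro t ht x hx
  have := key t (Ioc_subset_Icc_self ht) x hx
  simp only [hw, cal_of_lt ht.1] at this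
  linarith

end Summit.NavierStokesRegularity.NavierStokesRegularity.Theorems.AveragedConeLiouville.PositivityBarrier

end
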